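import Summits.ResolutionOfSingularities.ResolutionOfSingularities.Theorems.HomologicalConductorNoZenoSplitExcCount
import HarnessLib

/-!
# Crux `NoZenoR` / `NoZeno` (stmt-ResolutionOfSingularities-19943 / -16483), β layer, v24 `stub_L1wCore` brick (c4):
# COUNT-DROP ARITHMETIC for the split exceptional count `N^s`

Route `ResolutionOfSingularities/HomologicalConductor`.  OURS (cell res-hironaka, chain W4.4); nothing here is a statement
of the manuscript under review.  The phrasing-robust ARITHMETIC half of res-L0-w44-lead-1's brick (c4) of the geometric
core of (L1-w) («`N^s(D′) ≤ Σ_{old E ∈ G_y} w(E) ≤ N − 1`»), over U8's vocabulary (`ExcCount.splitWeight`,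
`ExcCount.splitExcCount`, `ExcCount.HasSplitExcCurveCountLE`, `…NoZenoSplitExcCount`): for two schemes over local
bases `π : X → Spec R`, `π′ : X′ → Spec R′` and an ARBITRARY map of points `φ : X′ → X` sending the integral
exceptional curves of `π′` injectively to integral exceptional curves of `π` WITHOUT INCREASING THE SPLIT WEIGHT,

* `splitExcCount_eq_sum` — `N^s(π)` as a `Finset` sum when the exceptional curves are finitely many;
* `splitExcCount_le_of_mapsTo` — `N^s(π′) ≤ N^s(π)`;
* `splitExcCount_lt_of_mapsTo_of_not_mem_image` — if moreover some exceptional curve of `π` is missed, `N^s(π′) < N^s(π)`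
  (every weight is `≥ 1`, U8's junk guard `one_le_splitWeight`), i.e. `N^s(π′) + 1 ≤ N^s(π)`
  (`splitExcCount_succ_le_of_mapsTo_of_not_mem_image`);
* `hasSplitExcCurveCountLE_pred_of_mapsTo` — the `HasSplitExcCurveCountLE` form: `π′` a minimal resolution of `R′`, `π` a
  minimal resolution of `R` with finitely many exceptional curves and `N^s(π) ≤ N`, such a `φ` missing a curve ⇒
  `HasSplitExcCurveCountLE R′ (N − 1)`.

The GEOMETRY of (c4) — which `φ` (strict transforms `Ē ↦ E` of the old curves surviving in the contracted configuration),
why the weight does not grow (separable degree is multiplicative, `[F:L]_s = [F:L′]_s · [L′:L]_s` for `κ ⊆ κ(P′) ⊆ κ(E)`),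
and why an old curve is missed (brick (c3)) — is NOT here.  AI-written; weaker than expert review.
-/

noncomputable section

-- single-problem summit: the doubled namespace component `ResolutionOfSingularities` is forced
set_option linter.dupNamespace false

namespace Summit.ResolutionOfSingularities.ResolutionOfSingularities.Theorems.NoZeno.ExcCount

open AlgebraicGeometry
open Literature.AlgebraicGeometry.Resolution

variable {R R' : Type} [CommRing R] [IsLocalRing R] [CommRing R'] [IsLocalRing R']
variable {X X' : Scheme.{0}} (π : X ⟶ Spec (.of R)) (π' : X' ⟶ Spec (.of R')) (φ : X' → X)

/-- `N^s` as a finite sum over the (finitely many) integral exceptional curves. [this work] -/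
theorem splitExcCount_eq_sum (hfin : (excCurvePoints π).Finite) :
    splitExcCount π = ∑ η ∈ hfin.toFinset, splitWeight π η := by
  unfold splitExcCount
  exact finsum_mem_eq_finite_toFinset_sum _ hfin

/-- **`N^s` does not increase along a weight-non-increasing injection of exceptional curves**: if `φ` maps
`excCurvePoints π′` injectively into the finite set `excCurvePoints π` with `splitWeight π′ η′ ≤ splitWeight π (φ η′)`,
then `splitExcCount π′ ≤ splitExcCount π`. [this work] -/
theorem splitExcCount_le_of_mapsTo (hfin : (excCurvePoints π).Finite)
    (hmaps : Set.MapsTo φ (excCurvePoints π') (excCurvePoints π))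
    (hinj : Set.InjOn φ (excCurvePoints π'))
    (hw : ∀ η' ∈ excCurvePoints π', splitWeight π' η' ≤ splitWeight π (φ η')) :
    splitExcCount π' ≤ splitExcCount π := by
  classical
  have hfin' : (excCurvePoints π').Finite :=
    Set.Finite.of_finite_image (hfin.subset hmaps.image_subset) hinj
  unfold splitExcCount
  rw [finsum_mem_eq_finite_toFinset_sum _ hfin', finsum_mem_eq_finite_toFinset_sum _ hfin]
  calc ∑ η' ∈ hfin'.toFinset, splitWeight π' η'
      ≤ ∑ η' ∈ hfin'.toFinset, splitWeight π (φ η') :=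
        Finset.sum_le_sum fun η' hη' => hw η' (hfin'.mem_toFinset.mp hη')
    _ = ∑ η ∈ hfin'.toFinset.image φ, splitWeight π η := by
        rw [Finset.sum_image]
        intro a ha b hb hab
        exact hinj (hfin'.mem_toFinset.mp ha) (hfin'.mem_toFinset.mp hb) hab
    _ ≤ ∑ η ∈ hfin.toFinset, splitWeight π η := by
        refine Finset.sum_le_sum_of_subset fun η hη => ?_
        obtain ⟨η', hη', rfl⟩ := Finset.mem_image.mp hη
        exact hfin.mem_toFinset.mpr (hmaps (hfin'.mem_toFinset.mp hη'))

/-- **`N^s` drops when an exceptional curve is missed**: under the hypotheses of `splitExcCount_le_of_mapsTo`, if some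
`η₀ ∈ excCurvePoints π` is not of the form `φ η′`, then `splitExcCount π′ < splitExcCount π` (the missed curve weighs
`≥ 1`, `one_le_splitWeight`). [this work] -/
theorem splitExcCount_lt_of_mapsTo_of_not_mem_image (hfin : (excCurvePoints π).Finite)
    (hmaps : Set.MapsTo φ (excCurvePoints π') (excCurvePoints π))
    (hinj : Set.InjOn φ (excCurvePoints π'))
    (hw : ∀ η' ∈ excCurvePoints π', splitWeight π' η' ≤ splitWeight π (φ η'))
    {η₀ : X} (hη₀ : η₀ ∈ excCurvePoints π) (hmiss : η₀ ∉ φ '' excCurvePoints π') :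
    splitExcCount π' < splitExcCount π := by
  classical
  have hfin' : (excCurvePoints π').Finite :=
    Set.Finite.of_finite_image (hfin.subset hmaps.image_subset) hinj
  unfold splitExcCount
  rw [finsum_mem_eq_finite_toFinset_sum _ hfin', finsum_mem_eq_finite_toFinset_sum _ hfin]
  calc ∑ η' ∈ hfin'.toFinset, splitWeight π' η'
      ≤ ∑ η' ∈ hfin'.toFinset, splitWeight π (φ η') :=
        Finset.sum_le_sum fun η' hη' => hw η' (hfin'.mem_toFinset.mp hη')
    _ = ∑ η ∈ hfin'.toFinset.image φ, splitWeight π η := by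
        rw [Finset.sum_image]
        intro a ha b hb hab
        exact hinj (hfin'.mem_toFinset.mp ha) (hfin'.mem_toFinset.mp hb) hab
    _ < ∑ η ∈ hfin.toFinset, splitWeight π η := by
        refine Finset.sum_lt_sum_of_subset (i := η₀) (fun η hη => ?_) (hfin.mem_toFinset.mpr hη₀) ?_
          (one_le_splitWeight π η₀) fun _ _ _ => Nat.zero_le _
        · obtain ⟨η', hη', rfl⟩ := Finset.mem_image.mp hη
          exact hfin.mem_toFinset.mpr (hmaps (hfin'.mem_toFinset.mp hη'))
        · intro h
          obtain ⟨η', hη', rfl⟩ := Finset.mem_image.mp h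
          exact hmiss ⟨η', hfin'.mem_toFinset.mp hη', rfl⟩

/-- `N^s(π′) + 1 ≤ N^s(π)` under the hypotheses of `splitExcCount_lt_of_mapsTo_of_not_mem_image`. [this work] -/
theorem splitExcCount_succ_le_of_mapsTo_of_not_mem_image (hfin : (excCurvePoints π).Finite)
    (hmaps : Set.MapsTo φ (excCurvePoints π') (excCurvePoints π))
    (hinj : Set.InjOn φ (excCurvePoints π'))
    (hw : ∀ η' ∈ excCurvePoints π', splitWeight π' η' ≤ splitWeight π (φ η'))
    {η₀ : X} (hη₀ : η₀ ∈ excCurvePoints π) (hmiss : η₀ ∉ φ '' excCurvePoints π') :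
    splitExcCount π' + 1 ≤ splitExcCount π :=
  Nat.succ_le_of_lt (splitExcCount_lt_of_mapsTo_of_not_mem_image π π' φ hfin hmaps hinj hw hη₀ hmiss)

/-- Finiteness of the exceptional curves upstairs is inherited along `φ`. [this work] -/
theorem excCurvePoints_finite_of_mapsTo (hfin : (excCurvePoints π).Finite)
    (hmaps : Set.MapsTo φ (excCurvePoints π') (excCurvePoints π))
    (hinj : Set.InjOn φ (excCurvePoints π')) : (excCurvePoints π').Finite :=
  Set.Finite.of_finite_image (hfin.subset hmaps.image_subset) hinj

/-- **The count drops by one, `HasSplitExcCurveCountLE` form (brick (c4), arithmetic half).**  Let `π′ : X′ → Spec R′`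
be a minimal resolution and `π : X → Spec R` any morphism with finitely many integral exceptional curves and
`N^s(π) ≤ N` (e.g. the minimal resolution realising `HasSplitExcCurveCountLE R N`); if some `φ : X′ → X` maps the exceptional curves of `π′` injectively and weight-non-increasingly into
those of `π` and misses one of them, then `HasSplitExcCurveCountLE R′ (N − 1)`. [this work] -/
theorem hasSplitExcCurveCountLE_pred_of_mapsTo {N : ℕ} (hπ' : IsMinimalResolution π')
    (hfin : (excCurvePoints π).Finite) (hN : splitExcCount π ≤ N)
    (hmaps : Set.MapsTo φ (excCurvePoints π') (excCurvePoints π))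
    (hinj : Set.InjOn φ (excCurvePoints π'))
    (hw : ∀ η' ∈ excCurvePoints π', splitWeight π' η' ≤ splitWeight π (φ η'))
    {η₀ : X} (hη₀ : η₀ ∈ excCurvePoints π) (hmiss : η₀ ∉ φ '' excCurvePoints π') :
    HasSplitExcCurveCountLE R' (N - 1) := by
  refine ⟨X', π', hπ', excCurvePoints_finite_of_mapsTo π π' φ hfin hmaps hinj, ?_⟩
  have h := splitExcCount_succ_le_of_mapsTo_of_not_mem_image π π' φ hfin hmaps hinj hw hη₀ hmiss
  omega

end Summit.ResolutionOfSingularities.ResolutionOfSingularities.Theorems.NoZeno.ExcCount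

end
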